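import Summits.AtomisticToContinuum.Crystallization.Theses.PricedLinkCensus
import Literature.MathematicalPhysics.StatisticalMechanics.LennardJonesClusters
import Summits.AtomisticToContinuum.Crystallization.Theorems.TruncatedCensusGap.Negative.KappaZeroHalf
import Summits.AtomisticToContinuum.Crystallization.Theorems.TruncatedCensusGap.Negative.WithoutInjective
import Summits.AtomisticToContinuum.Crystallization.Theorems.PricedLinkCensusTruncatedCensusGapBarlowIdentTruncLJ
import Summits.AtomisticToContinuum.Crystallization.Theorems.PricedLinkCensusTruncatedCensusGapHcpLeBarlow
import Summits.AtomisticToContinuum.Crystallization.Theorems.PricedLinkCensusTruncatedCensusGapPeriodicStability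
import Summits.AtomisticToContinuum.Crystallization.Theorems.PricedLinkCensusTruncatedCensusGapBarlowLayerSumsWindow
import Summits.AtomisticToContinuum.Crystallization.Theorems.PricedLinkCensusTruncatedCensusGapStrainedMarginCert
import Summits.AtomisticToContinuum.Crystallization.Theorems.PricedLinkCensusTruncatedCensusGapNearOfLocalPricing

/-!
# Line `near-far-split` — crux `PricedLinkCensus.TruncatedCensusGap` (stmt-AtomisticToContinuum-14230)

Crux strategist `planner-cstrat-stmt-AtomisticToContinuum-14230-s2-0` (2026-08-17), route
`route-AtomisticToContinuum-PricedLinkCensus`.  An ALTERNATIVE line (registered with `--alt`; it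
coexists with the lead's `Lines/birth.lean` and the three idea lines and replaces none of them).

THE CUT.  Split the charged sites of the crux by the GEOMETRY of each site's closed `3a`-patch, not
by its link census (birth: O/U/R), not by a tolerance band (mcc: M/T), not by a sharp zero set
(smpc) or a fine metric germ (ffcg r3):

* site `i` of `y` is **near-Barlow** (coarse) when for some scale `a ∈ [0.93, 1.02]` (tree units,
  `a* = 0.97707`), some layer spacing `c ∈ [0.78a, 0.86a]`, some Hägg word `s` and some rigid
  motion `g`, the configuration within `3a` of `y i` is `a/2`-separated and TWO-WAY `a/50`-MATCHED to
  `g '' barlowStacking a c s` (the `BallMatch` of `MuGroundStateConfiguration`, inlined);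
* `stub_barlowFarSiteGap` (FAR) — every site that is NOT near-Barlow costs `κ₂ > 0` above `N e_χ*`:
  finite-range crystallization for `V_χ` in coarse, priced form — no bond graph, no tolerance
  `1/100`, no ring numbers, no fine `c/a` window, no hcp-vs-fcc — THE OPEN CORE, and the weakest
  far-regime statement on the board (implied by smpc's `SharpLocalisationSeparated` and by ffcg r3's
  `MetricDefectGap`, both of which match at tolerance `≤ a/1000` on a spacing window `±1/250`);
* `stub_strainedBarlowMargin` (N1) — every periodic Barlow stacking in the near-window whose spacing
  ratio `c/a` lies outside `(0.808, 0.825)` (the references that are charged, or charge-free with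
  margin `< 0.4 %`; the charge-free window is `c/a ∈ [0.80434, 0.82871]`) sits `≥ μ > 0` above
  `e_χ*` — certified numerics on a two-variable landscape via the affine stacking law (p129223) and
  an explicit hcp reference `e_χ(hcp a₀ c₀) ≥ e_χ*`;
* `stub_harmonicCoercivityWindow` (N2) — uniform harmonic coercivity of EVERY Barlow polytype under
  `V_χ` on the near-window `a ∈ [0.93, 1.02]`, `c ∈ [0.78a, 0.86a]` (line mcc's registered
  `stub_harmonicCoercivity`, which is the ideal-spacing slice `c = a√(2/3)`, `a ∈ [0.96, 0.99]`,
  Bloch constants `0.41–0.42`, kit j013269) — certified transfer-matrix numerics + lattice Korn;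
* `stub_nearPricingEngine` (N3) — `N1 → N2 → NEAR`, NEAR = "near-and-charged sites cost `κ₁ > 0`
  above `N e_χ*` up to an allowance `C` per far site": the discrete-rigidity engine (best-fit rigid
  motion per patch, octet-truss rigidity, first-order terms = flux through near/far interfaces
  `≤ C` per far site by finite range and `V_χ ≥ −1/12`, second order by N2 on the `a/50` basin,
  threshold lever from the charge-free margin of the references (p125113, window `[0.812, 0.821]`,
  here `[0.808, 0.825]` with margin `≥ 0.35 %`), landscape margin N1 for strained references).

RESHAPE r1 (lead c5, prover-line-stmt-AtomisticToContinuum-14230-c5-0, 2026-08-17): N1 is DERIVED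
(`strainedBarlowMargin_of_cert`, proved here: affine stacking law p129223 + energy identity
p129723 + `ciInf_le` under `stub_periodicStability` p84999 against the explicit reference
`hcp(0.977, 0.797)`) from two registered stubs — `stub_barlowLayerSumsWindow` (N1a: the four
lattice sums of `V_χ` on the window are explicit finite class sums; bookkeeping) and
`stub_strainedMarginCert` (N1b: the certified two-variable interval computation on those class
sums, margin `2.44e-4` numerically at `(a, h/a) = (0.9805, 0.808)`; the lead's own stub).
Registered stubs after r1: FAR, N1a, N1b, N2, N3 (5 ≤ 7).  STATUS (lead c5, cycle 1): N1a LANDED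
p167941, N1b LANDED p168897 — N1 `StrainedBarlowMargin` is PROVED (`strainedBarlowMargin_holds` below);
open: FAR (open core), N2, N3.

RESHAPE r2 (lead c5 after the N3 worker's S4–S6 analysis, briefs/PLAN-N3.md + R2-notes.md, 2026-08-17): N3 as
registered (N1 → N2 → NEAR) is NOT closable — the global Bloch coercivity N2 cannot be localised to `3a`-charts
(IMS cost `‖H‖(a/R)² ≈ 3 ≫ κ ≈ 0.12–0.45`), charts of different near sites cannot be unified beyond ≈ 6a
(cross-chart regrouping loss/gain ratio `‖h‖/κ ≈ 10–40` at tolerance `a/50`), and the single-chart patch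
statement degenerates (inner ball `3a − 2 − a/25 < a` is one site).  The irreducible near-half hypothesis is
CHART-FREE: N2′ `LocalNearPricing` (zero-sum bounded transfers, deep-near sites priced at `e_χ*`, charged ones
at `e_χ* + κ`), from which NEAR follows by bookkeeping (N3′ `stub_nearOfLocalPricing`, M-sized).  N2′ is rated
OPEN-PROBLEM-SIZED: the line now isolates TWO open cores, FAR and N2′; N1 (PROVED), the landscape package N1c,
the Bloch/torus machinery of N2 (landed p167634 … p168991) and the free-patch numerics are inputs/evidence for
N2′.  Registered stubs after r2: `stub_barlowFarSiteGap`, `stub_localNearPricing`, `stub_nearOfLocalPricing` — the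
last LANDED in wave 2 (p169781), so the skeleton's sorries are exactly the two open cores FAR and N2′.
EVIDENCE LANDED for N2′ (lead c5): the landscape package N1c — whole-window certified inequalities on the
class sums (`landscapeC1` fcc-like margin 19/1e5, `landscapeC2` mixed-layer margin 19/2e5, `landscapeC3/C4`
quadratic strain floors `5((a − 0.977)² + (c − 0.797)²) − 10⁻⁶`), Theorems
`…LandscapeCertDefs/Sound/RunA/RunH1–4/LandscapePackage` (p170403, p170648, p170650–p170654, p171044); the
composition `truncatedCensusGap_of_far_of_localNearPricing` is importable (`…NearFarComposition`, p170131).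

COMPOSITION (`TruncatedCensusGap_of`, sorry-free): a charged site is near-and-charged or far, so
`#charged ≤ #(charged ∧ near) + #far`; with `κ₂ #far ≤ E − N e*` (FAR) and
`κ₁ #(charged ∧ near) ≤ E − N e* + C #far` (NEAR = N3 N1 N2) the crux holds with
`κ := κ₁κ₂/(κ₁ + κ₂ + max C 0)` — the glue `truncatedCensusGap_of_nearFarSplit` proved in §4
(also attached to the item as `NearFarSplit.lean`, v2).

DISPROOF USED (`Cruxes/TruncatedCensusGap/Disproof.lean`, cdisprove g2; landed Negative lemmas
imported above): `truncatedCensusGap_false_without_injective` honoured — FAR and NEAR keep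
`Function.Injective y` and N3 USES it (crowded far clusters are refunded by Ruelle superstability
of `V_χ`, p124427; `a/2`-separation inside near patches identifies sites with points);
`truncatedCensusGap_kappa_zero_iff_bddBelow` / `KappaZeroHalf` honoured — `e_χ*` enters FAR, NEAR
and N1 only UPWARD (`ciInf_le` needs `BddBelow`, landed p84999 `stub_periodicStability`), never as a
number; §6 numerics (`κ ≤ 2.7e-5`, compressed pair): a NEAR event (both atoms displaced `< a/50`),
consistent with `κ₁ ~ 1e-5`; `-- Targets`: none filed.  No stub is an instance of a landed Negative
lemma (FAR/NEAR/N1 carry the genuine infimum and injectivity; N2 is potential-side linear algebra).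
-/

noncomputable section

namespace Summit.AtomisticToContinuum.Crystallization.Cruxes.TruncatedCensusGap.NearFarSplit

open scoped BigOperators Classical
open Literature.MathematicalPhysics.StatisticalMechanics Literature.Geometry.DiscreteGeometry
open Summit.AtomisticToContinuum.Crystallization.Theses.PricedLinkCensus (TruncatedCensusGap)

/-! ## §1 The statements (named Props; the registered stubs of §2 restate them verbatim) -/

/-- **(FAR) Barlow far-site gap** — sites whose closed `3a`-patch is not coarsely Barlow pay `κ₂`. -/
def BarlowFarSiteGap : Prop :=
  ∃ κ : ℝ, 0 < κ ∧ ∀ (N : ℕ) (y : Fin N → EuclideanSpace ℝ (Fin 3)), Function.Injective y → (N : ℝ) * (⨅ Q : Literature.MathematicalPhysics.StatisticalMechanics.PeriodicConfiguration 3, Q.energyPerParticle (fun r => min 1 (max 0 (4 - 2 * r)) * Literature.MathematicalPhysics.StatisticalMechanics.lennardJones r)) + κ * (Nat.card {i : Fin N // ¬ ∃ (a c : ℝ) (s : ℤ → ℤ) (g : EuclideanSpace ℝ (Fin 3) ≃ᵃⁱ[ℝ] EuclideanSpace ℝ (Fin 3)), 93 / 100 ≤ a ∧ a ≤ 51 /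 50 ∧ 78 / 100 * a ≤ c ∧ c ≤ 86 / 100 * a ∧ Literature.MathematicalPhysics.StatisticalMechanics.IsHaggSeq s ∧ (∀ j k : Fin N, j ≠ k → dist (y j) (y i) ≤ 3 * a → a / 2 ≤ dist (y j) (y k)) ∧ (∀ j : Fin N, dist (y j) (y i) ≤ 3 * a → ∃ z ∈ Literature.MathematicalPhysics.StatisticalMechanics.barlowStacking a c s, dist (y j) (g z) ≤ a / 50) ∧ (∀ z ∈ Literature.MathematicalPhysics.StatisticalMechanics.barlowStacking a c s, dist (g z) (y i) ≤ 3 * a → ∃ j : Fin N, dist (y j) (g z) ≤ a / 50)} : ℝ) ≤ Literature.MathematicalPhysics.StatisticalMechanics.interactionEnergy (fun r => min 1 (max 0 (4 - 2 * r)) * Literature.MathematicalPhysics.StatisticalMechanics.lennardJones r) y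

/-- **(NEAR) near-site charge pricing with far allowance** — charged sites whose `3a`-patch IS
coarsely Barlow pay `κ₁`, up to `C` per far site. -/
def NearBarlowChargePricing : Prop :=
  ∃ κ C : ℝ, 0 < κ ∧ ∀ (N : ℕ) (y : Fin N → EuclideanSpace ℝ (Fin 3)), Function.Injective y → (N : ℝ) * (⨅ Q : Literature.MathematicalPhysics.StatisticalMechanics.PeriodicConfiguration 3, Q.energyPerParticle (fun r => min 1 (max 0 (4 - 2 * r)) * Literature.MathematicalPhysics.StatisticalMechanics.lennardJones r)) + κ * (Nat.card {i : Fin N // ¬ Literature.Geometry.DiscreteGeometry.IsChargeFree (1 / 100 : ℝ) y i ∧ ∃ (a c : ℝ) (s : ℤ → ℤ) (g : EuclideanSpace ℝ (Fin 3) ≃ᵃⁱ[ℝ] EuclideanSpace ℝ (Fin 3)), 93 / 100 ≤ a ∧ a ≤ 51 / 50 ∧ 78 / 100 * a ≤ c ∧ c ≤ 86 / 100 * a ∧ Literature.MathematicalPhysics.StatisticalMechanics.IsHaggSeq s ∧ (∀ j k : Fin N, j ≠ k → dist (y j) (y i) ≤ 3 * a → a / 2 ≤ dist (y j) (y k)) ∧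 (∀ j : Fin N, dist (y j) (y i) ≤ 3 * a → ∃ z ∈ Literature.MathematicalPhysics.StatisticalMechanics.barlowStacking a c s, dist (y j) (g z) ≤ a / 50) ∧ (∀ z ∈ Literature.MathematicalPhysics.StatisticalMechanics.barlowStacking a c s, dist (g z) (y i) ≤ 3 * a → ∃ j : Fin N, dist (y j) (g z) ≤ a / 50)} : ℝ) ≤ Literature.MathematicalPhysics.StatisticalMechanics.interactionEnergy (fun r => min 1 (max 0 (4 - 2 * r)) * Literature.MathematicalPhysics.StatisticalMechanics.lennardJones r) y + C * (Nat.card {i : Fin N // ¬ ∃ (a c : ℝ) (s : ℤ → ℤ) (g : EuclideanSpace ℝ (Fin 3) ≃ᵃⁱ[ℝ] EuclideanSpace ℝ (Fin 3)), 93 / 100 ≤ a ∧ a ≤ 51 / 50 ∧ 78 / 100 * a ≤ c ∧ c ≤ 86 / 100 * a ∧ Literature.MathematicalPhysics.StatisticalMechanics.IsHaggSeq s ∧ (∀ j k : Fin N, j ≠ k → dist (y j) (y i) ≤ 3 * a → a / 2 ≤ dist (y j) (y k)) ∧ (∀ j : Fin N, dist (y j) (y i) ≤ 3 * a → ∃ z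 ∈ Literature.MathematicalPhysics.StatisticalMechanics.barlowStacking a c s, dist (y j) (g z) ≤ a / 50) ∧ (∀ z ∈ Literature.MathematicalPhysics.StatisticalMechanics.barlowStacking a c s, dist (g z) (y i) ≤ 3 * a → ∃ j : Fin N, dist (y j) (g z) ≤ a / 50)} : ℝ)

/-- **(N1) strained-Barlow margin** — periodic Barlow stackings in the near-window with spacing ratio
outside `(0.808, 0.825)` sit `≥ μ` above the periodic infimum `e_χ*`. -/
def StrainedBarlowMargin : Prop :=
  ∃ μ : ℝ, 0 < μ ∧ ∀ (a h : ℝ) (s : ℤ → ℤ) (p : ℕ) (ha : a ≠ 0) (hh : h ≠ 0) (hp : p ≠ 0) (hs : ∀ i : ℤ, s (i + p) = s i), 93 / 100 ≤ a → a ≤ 51 / 50 → 78 / 100 * a ≤ h → h ≤ 86 / 100 * a → (h ≤ 808 / 1000 * a ∨ 825 / 1000 * a ≤ h) → Literature.MathematicalPhysics.StatisticalMechanics.IsHaggSeq s → (⨅ Q : Literature.MathematicalPhysics.StatisticalMechanics.PeriodicConfiguration 3, Q.energyPerParticle (fun r => min 1 (max 0 (4 - 2 * r)) * Literature.MathematicalPhysics.StatisticalMechanics.lennardJones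 r)) + μ ≤ (Literature.MathematicalPhysics.StatisticalMechanics.barlowPeriodicConfiguration s ha hh hp hs).energyPerParticle (fun r => min 1 (max 0 (4 - 2 * r)) * Literature.MathematicalPhysics.StatisticalMechanics.lennardJones r)

/-- **(N1a) finite layer sums on the window** — for `a ≥ 0.93`, `h ≥ 0.72` the four lattice sums
of `V_χ` entering the affine stacking law are EXPLICIT finite class sums (in-layer shells at
`a, √3 a, 2a`; adjacent layer at `√(a²/3+h²), √(4a²/3+h²), √(7a²/3+h²)`; second layer
non-aligned at `√(a²/3+4h²), √(4a²/3+4h²)`, aligned at `2h, √(a²+4h²)`), and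
`e₀ = ½ Φ₀ + Φ_N(1) + Φ_N(2)` (layers at distance `≥ 3` are out of range).  Bookkeeping
(reshape r1 of lead c5). -/
def BarlowLayerSumsWindow : Prop :=
  ∀ (a h : ℝ), 93 / 100 ≤ a → 72 / 100 ≤ h → Literature.MathematicalPhysics.StatisticalMechanics.inLayerInteraction (fun r => min 1 (max 0 (4 - 2 * r)) * Literature.MathematicalPhysics.StatisticalMechanics.lennardJones r) a = 6 * (min 1 (max 0 (4 - 2 * a)) * Literature.MathematicalPhysics.StatisticalMechanics.lennardJones a) + 6 * (min 1 (max 0 (4 - 2 * (√3 * a))) * Literature.MathematicalPhysics.StatisticalMechanics.lennardJones (√3 * a)) + 6 * (min 1 (max 0 (4 - 2 * (2 * a))) * Literature.MathematicalPhysics.StatisticalMechanics.lennardJones (2 * a)) ∧ Literature.MathematicalPhysics.StatisticalMechanics.layerInteraction (fun r => min 1 (max 0 (4 - 2 * r)) * Literature.MathematicalPhysics.StatisticalMechanics.lennardJones r) a h 1 1 = 3 * (min 1 (max 0 (4 - 2 * (√(a ^ 2 / 3 + h ^ 2)))) * Literature.MathematicalPhysics.StatisticalMechanics.lennardJones (√(a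 ^ 2 / 3 + h ^ 2))) + 3 * (min 1 (max 0 (4 - 2 * (√(4 * a ^ 2 / 3 + h ^ 2)))) * Literature.MathematicalPhysics.StatisticalMechanics.lennardJones (√(4 * a ^ 2 / 3 + h ^ 2))) + 6 * (min 1 (max 0 (4 - 2 * (√(7 * a ^ 2 / 3 + h ^ 2)))) * Literature.MathematicalPhysics.StatisticalMechanics.lennardJones (√(7 * a ^ 2 / 3 + h ^ 2))) ∧ Literature.MathematicalPhysics.StatisticalMechanics.layerInteraction (fun r => min 1 (max 0 (4 - 2 * r)) * Literature.MathematicalPhysics.StatisticalMechanics.lennardJones r) a h 1 2 = 3 * (min 1 (max 0 (4 - 2 * (√(a ^ 2 / 3 + 4 * h ^ 2)))) * Literature.MathematicalPhysics.StatisticalMechanics.lennardJones (√(a ^ 2 / 3 + 4 * h ^ 2))) + 3 * (min 1 (max 0 (4 - 2 * (√(4 * a ^ 2 / 3 + 4 * h ^ 2)))) * Literature.MathematicalPhysics.StatisticalMechanics.lennardJones (√(4 * a ^ 2 / 3 + 4 * h ^ 2))) ∧ Literature.MathematicalPhysics.StatisticalMechanics.layerInteraction (fun r => min 1 (max 0 (4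 - 2 * r)) * Literature.MathematicalPhysics.StatisticalMechanics.lennardJones r) a h 0 2 = (min 1 (max 0 (4 - 2 * (2 * h))) * Literature.MathematicalPhysics.StatisticalMechanics.lennardJones (2 * h)) + 6 * (min 1 (max 0 (4 - 2 * (√(a ^ 2 + 4 * h ^ 2)))) * Literature.MathematicalPhysics.StatisticalMechanics.lennardJones (√(a ^ 2 + 4 * h ^ 2))) ∧ Literature.MathematicalPhysics.StatisticalMechanics.barlowBaseEnergy (fun r => min 1 (max 0 (4 - 2 * r)) * Literature.MathematicalPhysics.StatisticalMechanics.lennardJones r) a h = 1 / 2 * Literature.MathematicalPhysics.StatisticalMechanics.inLayerInteraction (fun r => min 1 (max 0 (4 - 2 * r)) * Literature.MathematicalPhysics.StatisticalMechanics.lennardJones r) a + (Literature.MathematicalPhysics.StatisticalMechanics.layerInteraction (fun r => min 1 (max 0 (4 - 2 * r)) * Literature.MathematicalPhysics.StatisticalMechanics.lennardJones r) a h 1 1 + Literature.MathematicalPhysics.StatisticalMechanics.layerInteraction (fun r => min 1 (max 0 (4 - 2 * r)) * Literature.MathematicalPhysics.StatisticalMechanics.lennardJones r) a h 1 2)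

/-- **(N1b) the strained-margin certificate** — on the strained part of the near-window both
affine endpoints `F_fcc = e₀` and `F_hcp = e₀ + J₂` of the stacking energy sit `≥ μ` above the
explicit hcp reference value `F_hcp(0.977, 0.797) (≥ e_χ*)` (certified two-variable interval
computation; numerically the margin is `2.44e-4` at `(a, h/a) = (0.9805, 0.808)`; reshape r1). -/
def StrainedMarginCert : Prop :=
  ∃ μ : ℝ, 0 < μ ∧ ∀ a h : ℝ, 93 / 100 ≤ a → a ≤ 51 / 50 → 78 / 100 * a ≤ h → h ≤ 86 / 100 * a → (h ≤ 808 / 1000 * a ∨ 825 / 1000 * a ≤ h) → 3 * (min 1 (max 0 (4 - 2 * (977 / 1000))) * Literature.MathematicalPhysics.StatisticalMechanics.lennardJones (977 / 1000)) + 3 * (min 1 (max 0 (4 - 2 * (√3 * (977 / 1000)))) * Literature.MathematicalPhysics.StatisticalMechanics.lennardJones (√3 * (977 / 1000))) + 3 * (min 1 (max 0 (4 - 2 * (2 * (977 / 1000)))) * Literature.MathematicalPhysics.StatisticalMechanics.lennardJones (2 * (977 / 1000))) + 3 * (min 1 (max 0 (4 - 2 * (√((977 / 1000) ^ 2 / 3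 + (797 / 1000) ^ 2)))) * Literature.MathematicalPhysics.StatisticalMechanics.lennardJones (√((977 / 1000) ^ 2 / 3 + (797 / 1000) ^ 2))) + 3 * (min 1 (max 0 (4 - 2 * (√(4 * (977 / 1000) ^ 2 / 3 + (797 / 1000) ^ 2)))) * Literature.MathematicalPhysics.StatisticalMechanics.lennardJones (√(4 * (977 / 1000) ^ 2 / 3 + (797 / 1000) ^ 2))) + 6 * (min 1 (max 0 (4 - 2 * (√(7 * (977 / 1000) ^ 2 / 3 + (797 / 1000) ^ 2)))) * Literature.MathematicalPhysics.StatisticalMechanics.lennardJones (√(7 * (977 / 1000) ^ 2 / 3 + (797 / 1000) ^ 2))) + (min 1 (max 0 (4 - 2 * (2 * (797 / 1000)))) * Literature.MathematicalPhysics.StatisticalMechanics.lennardJones (2 * (797 / 1000))) + 6 * (min 1 (max 0 (4 - 2 * (√((977 / 1000) ^ 2 + 4 * (797 / 1000) ^ 2)))) * Literature.MathematicalPhysics.StatisticalMechanics.lennardJones (√((977 / 1000) ^ 2 + 4 * (797 / 1000) ^ 2))) + μ ≤ min (3 * (min 1 (max 0 (4 - 2 * a)) * Literature.MathematicalPhysics.StatisticalMechanics.lennardJones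 a) + 3 * (min 1 (max 0 (4 - 2 * (√3 * a))) * Literature.MathematicalPhysics.StatisticalMechanics.lennardJones (√3 * a)) + 3 * (min 1 (max 0 (4 - 2 * (2 * a))) * Literature.MathematicalPhysics.StatisticalMechanics.lennardJones (2 * a)) + 3 * (min 1 (max 0 (4 - 2 * (√(a ^ 2 / 3 + h ^ 2)))) * Literature.MathematicalPhysics.StatisticalMechanics.lennardJones (√(a ^ 2 / 3 + h ^ 2))) + 3 * (min 1 (max 0 (4 - 2 * (√(4 * a ^ 2 / 3 + h ^ 2)))) * Literature.MathematicalPhysics.StatisticalMechanics.lennardJones (√(4 * a ^ 2 / 3 + h ^ 2))) + 6 * (min 1 (max 0 (4 - 2 * (√(7 * a ^ 2 / 3 + h ^ 2)))) * Literature.MathematicalPhysics.StatisticalMechanics.lennardJones (√(7 * a ^ 2 / 3 + h ^ 2))) + 3 * (min 1 (max 0 (4 - 2 * (√(a ^ 2 / 3 + 4 * h ^ 2)))) * Literature.MathematicalPhysics.StatisticalMechanics.lennardJones (√(a ^ 2 / 3 + 4 * h ^ 2))) + 3 * (min 1 (max 0 (4 - 2 * (√(4 * a ^ 2 / 3 +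 4 * h ^ 2)))) * Literature.MathematicalPhysics.StatisticalMechanics.lennardJones (√(4 * a ^ 2 / 3 + 4 * h ^ 2)))) (3 * (min 1 (max 0 (4 - 2 * a)) * Literature.MathematicalPhysics.StatisticalMechanics.lennardJones a) + 3 * (min 1 (max 0 (4 - 2 * (√3 * a))) * Literature.MathematicalPhysics.StatisticalMechanics.lennardJones (√3 * a)) + 3 * (min 1 (max 0 (4 - 2 * (2 * a))) * Literature.MathematicalPhysics.StatisticalMechanics.lennardJones (2 * a)) + 3 * (min 1 (max 0 (4 - 2 * (√(a ^ 2 / 3 + h ^ 2)))) * Literature.MathematicalPhysics.StatisticalMechanics.lennardJones (√(a ^ 2 / 3 + h ^ 2))) + 3 * (min 1 (max 0 (4 - 2 * (√(4 * a ^ 2 / 3 + h ^ 2)))) * Literature.MathematicalPhysics.StatisticalMechanics.lennardJones (√(4 * a ^ 2 / 3 + h ^ 2))) + 6 * (min 1 (max 0 (4 - 2 * (√(7 * a ^ 2 / 3 + h ^ 2)))) * Literature.MathematicalPhysics.StatisticalMechanics.lennardJones (√(7 * a ^ 2 / 3 + h ^ 2))) + (min 1 (max 0 (4 - 2 * (2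 * h))) * Literature.MathematicalPhysics.StatisticalMechanics.lennardJones (2 * h)) + 6 * (min 1 (max 0 (4 - 2 * (√(a ^ 2 + 4 * h ^ 2)))) * Literature.MathematicalPhysics.StatisticalMechanics.lennardJones (√(a ^ 2 + 4 * h ^ 2))))

/-- **(N2) harmonic coercivity on the near-window** — the `V_χ` pair-Hessian form of every Barlow
stacking `barlowStacking a c s` (`s` Hägg, `a ∈ [0.93, 1.02]`, `c ∈ [0.78a, 0.86a]`) dominates
`κ ×` the nearest-neighbour difference form, for finitely supported displacement fields. -/
def HarmonicCoercivityWindow : Prop :=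
  let kTan : ℝ → ℝ := fun r => if r < 3 / 2 then (-(r⁻¹) ^ 13 + (r⁻¹) ^ 7) / r else if r < 2 then (-2 * Literature.MathematicalPhysics.StatisticalMechanics.lennardJones r + (4 - 2 * r) * (-(r⁻¹) ^ 13 + (r⁻¹) ^ 7)) / r else 0; let kRad : ℝ → ℝ := fun r => if r < 3 / 2 then 13 * (r⁻¹) ^ 14 - 7 * (r⁻¹) ^ 8 else if r < 2 then -4 * (-(r⁻¹) ^ 13 + (r⁻¹) ^ 7) + (4 - 2 * r) * (13 * (r⁻¹) ^ 14 - 7 * (r⁻¹) ^ 8) else 0; let hessV : EuclideanSpace ℝ (Fin 3) → EuclideanSpace ℝ (Fin 3) → ℝ := fun e w => kRad ‖e‖ * (inner ℝ e w / ‖e‖) ^ 2 + kTan ‖e‖ * (‖w‖ ^ 2 - (inner ℝ e w / ‖e‖) ^ 2); ∃ κ : ℝ, 0 < κ ∧ ∀ s : ℤ → ℤ, Literature.MathematicalPhysics.StatisticalMechanics.IsHaggSeq s → ∀ a h : ℝ, 93 / 100 ≤ a → a ≤ 51 / 50 → 78 / 100 * a ≤ h → h ≤ 86 / 100 * a → ∀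 u : EuclideanSpace ℝ (Fin 3) → EuclideanSpace ℝ (Fin 3), (Function.support u).Finite → Function.support u ⊆ Literature.MathematicalPhysics.StatisticalMechanics.barlowStacking a h s → κ * (∑' p : Literature.MathematicalPhysics.StatisticalMechanics.barlowStacking a h s, ∑' q : Literature.MathematicalPhysics.StatisticalMechanics.barlowStacking a h s, if dist (p : EuclideanSpace ℝ (Fin 3)) q ≤ 11 / 10 * a then ‖u p - u q‖ ^ 2 else 0) ≤ (∑' p : Literature.MathematicalPhysics.StatisticalMechanics.barlowStacking a h s, ∑' q : Literature.MathematicalPhysics.StatisticalMechanics.barlowStacking a h s, if (p : EuclideanSpace ℝ (Fin 3)) ≠ q then hessV ((p : EuclideanSpace ℝ (Fin 3)) - q) (u p - u q) else 0) / 2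

/-- **(N2′) local near pricing** (reshape r2; typed by the N3 worker of lead c5, briefs/R2-*): there are
zero-sum, uniformly bounded transfers `F` such that every DEEP-near site (all sites within `ρ` are near) has
redistributed half-site-energy `½ e_i + F_i ≥ e_χ*`, and `≥ e_χ* + κ` if it is charged.  Chart-free; the
irreducible content of the near half (the N3 worker's S4–S6 analysis: every chart-based perturbative route —
the card's (i)–(v), the patch statement, global Bloch N2 — founders on the cross-chart/localisation ratio
`‖h‖/κ ≈ 10–40` at tolerance `a/50`, chart radius `3a`).  OPEN-PROBLEM-SIZED (a Flyspeck-type local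
inequality programme for `V_χ` around near-window Barlow stackings), like FAR. -/
def LocalNearPricing : Prop :=
  ∃ κ C ρ : ℝ, 0 < κ ∧ ∃ F : (N : ℕ) → (Fin N → EuclideanSpace ℝ (Fin 3)) → Fin N → ℝ, (∀ (N : ℕ) (y : Fin N → EuclideanSpace ℝ (Fin 3)), Function.Injective y → ∑ i, F N y i = 0) ∧ (∀ (N : ℕ) (y : Fin N → EuclideanSpace ℝ (Fin 3)) (i : Fin N), Function.Injective y → |F N y i| ≤ C) ∧ ∀ (N : ℕ) (y : Fin N → EuclideanSpace ℝ (Fin 3)) (i : Fin N), Function.Injective y → (∀ i' : Fin N, dist (y i') (y i) ≤ ρ → ∃ (a c : ℝ) (s : ℤ → ℤ) (g : EuclideanSpace ℝ (Fin 3) ≃ᵃⁱ[ℝ] EuclideanSpace ℝ (Fin 3)), 93 / 100 ≤ a ∧ a ≤ 51 / 50 ∧ 78 / 100 * a ≤ c ∧ c ≤ 86 / 100 * a ∧ Literature.MathematicalPhysics.StatisticalMechanics.IsHaggSeq s ∧ (∀ j k : Fin N, j ≠ k → dist (y j) (y i') ≤ 3 * a → a / 2 ≤ dist (y j) (y k))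 ∧ (∀ j : Fin N, dist (y j) (y i') ≤ 3 * a → ∃ z ∈ Literature.MathematicalPhysics.StatisticalMechanics.barlowStacking a c s, dist (y j) (g z) ≤ a / 50) ∧ (∀ z ∈ Literature.MathematicalPhysics.StatisticalMechanics.barlowStacking a c s, dist (g z) (y i') ≤ 3 * a → ∃ j : Fin N, dist (y j) (g z) ≤ a / 50)) → (⨅ Q : Literature.MathematicalPhysics.StatisticalMechanics.PeriodicConfiguration 3, Q.energyPerParticle (fun r => min 1 (max 0 (4 - 2 * r)) * Literature.MathematicalPhysics.StatisticalMechanics.lennardJones r)) ≤ Literature.MathematicalPhysics.StatisticalMechanics.siteEnergy (fun r => min 1 (max 0 (4 - 2 * r)) * Literature.MathematicalPhysics.StatisticalMechanics.lennardJones r) y i / 2 + F N y i ∧ (¬ Literature.Geometry.DiscreteGeometry.IsChargeFree (1 / 100 : ℝ) y i → (⨅ Q : Literature.MathematicalPhysics.StatisticalMechanics.PeriodicConfiguration 3, Q.energyPerParticle (fun r => min 1 (max 0 (4 - 2 * r)) * Literature.MathematicalPhysics.StatisticalMechanics.lennardJones r)) + κ ≤ Literature.MathematicalPhysics.StatisticalMechanics.siteEnergy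 (fun r => min 1 (max 0 (4 - 2 * r)) * Literature.MathematicalPhysics.StatisticalMechanics.lennardJones r) y i / 2 + F N y i)

/-- **(NEAR′)** `NearBarlowChargePricing` with the near set passed as a `Finset` characterised by the near
predicate (one occurrence of the predicate; registrable length); `nearBarlowChargePricing_of_prime` below
recovers NEAR. -/
def NearBarlowChargePricing' : Prop :=
  ∃ κ C : ℝ, 0 < κ ∧ ∀ (N : ℕ) (y : Fin N → EuclideanSpace ℝ (Fin 3)), Function.Injective y → ∀ S : Finset (Fin N), (∀ i : Fin N, i ∈ S ↔ ∃ (a c : ℝ) (s : ℤ → ℤ) (g : EuclideanSpace ℝ (Fin 3) ≃ᵃⁱ[ℝ] EuclideanSpace ℝ (Fin 3)), 93 / 100 ≤ a ∧ a ≤ 51 / 50 ∧ 78 / 100 * a ≤ c ∧ c ≤ 86 / 100 * a ∧ Literature.MathematicalPhysics.StatisticalMechanics.IsHaggSeq s ∧ (∀ j k : Fin N, j ≠ k → dist (y j) (y i) ≤ 3 * a → a / 2 ≤ dist (y j) (y k)) ∧ (∀ j : Fin N, dist (y j) (y i) ≤ 3 * a → ∃ z ∈ Literature.MathematicalPhysics.StatisticalMechanics.barlowStacking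 a c s, dist (y j) (g z) ≤ a / 50) ∧ (∀ z ∈ Literature.MathematicalPhysics.StatisticalMechanics.barlowStacking a c s, dist (g z) (y i) ≤ 3 * a → ∃ j : Fin N, dist (y j) (g z) ≤ a / 50)) → (N : ℝ) * (⨅ Q : Literature.MathematicalPhysics.StatisticalMechanics.PeriodicConfiguration 3, Q.energyPerParticle (fun r => min 1 (max 0 (4 - 2 * r)) * Literature.MathematicalPhysics.StatisticalMechanics.lennardJones r)) + κ * (Nat.card {i : Fin N // ¬ Literature.Geometry.DiscreteGeometry.IsChargeFree (1 / 100 : ℝ) y i ∧ i ∈ S} : ℝ) ≤ Literature.MathematicalPhysics.StatisticalMechanics.interactionEnergy (fun r => min 1 (max 0 (4 - 2 * r)) * Literature.MathematicalPhysics.StatisticalMechanics.lennardJones r) y + C * ((Finset.univ \ S).card : ℝ)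

/-! ## §2 The registered stubs (`sorry` lives only in these four theorems) -/

/-- **STUB (FAR)** `stub_barlowFarSiteGap` — THE OPEN CORE (finite-range crystallization for `V_χ`,
coarse, priced; XL / open-problem). -/
theorem stub_barlowFarSiteGap :
    ∃ κ : ℝ, 0 < κ ∧ ∀ (N : ℕ) (y : Fin N → EuclideanSpace ℝ (Fin 3)), Function.Injective y → (N : ℝ) * (⨅ Q : Literature.MathematicalPhysics.StatisticalMechanics.PeriodicConfiguration 3, Q.energyPerParticle (fun r => min 1 (max 0 (4 - 2 * r)) * Literature.MathematicalPhysics.StatisticalMechanics.lennardJones r)) + κ * (Nat.card {i : Fin N // ¬ ∃ (a c : ℝ) (s : ℤ → ℤ) (g : EuclideanSpace ℝ (Fin 3) ≃ᵃⁱ[ℝ] EuclideanSpace ℝ (Fin 3)), 93 / 100 ≤ a ∧ a ≤ 51 / 50 ∧ 78 / 100 * a ≤ c ∧ c ≤ 86 / 100 * a ∧ Literature.MathematicalPhysics.StatisticalMechanics.IsHaggSeq s ∧ (∀ j k : Fin N, j ≠ k → dist (y j) (y i) ≤ 3 * a → a / 2 ≤ dist (y j) (y k)) ∧ (∀ j :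 Fin N, dist (y j) (y i) ≤ 3 * a → ∃ z ∈ Literature.MathematicalPhysics.StatisticalMechanics.barlowStacking a c s, dist (y j) (g z) ≤ a / 50) ∧ (∀ z ∈ Literature.MathematicalPhysics.StatisticalMechanics.barlowStacking a c s, dist (g z) (y i) ≤ 3 * a → ∃ j : Fin N, dist (y j) (g z) ≤ a / 50)} : ℝ) ≤ Literature.MathematicalPhysics.StatisticalMechanics.interactionEnergy (fun r => min 1 (max 0 (4 - 2 * r)) * Literature.MathematicalPhysics.StatisticalMechanics.lennardJones r) y := by
  sorry

example : BarlowFarSiteGap := stub_barlowFarSiteGap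

/-- **N1a `stub_barlowLayerSumsWindow` — LANDED** (p167941, stub-worker of lead c5,
`Theorems/PricedLinkCensusTruncatedCensusGapBarlowLayerSumsWindow.lean`): the finite class sums. -/
theorem stub_barlowLayerSumsWindow :
    ∀ (a h : ℝ), 93 / 100 ≤ a → 72 / 100 ≤ h → Literature.MathematicalPhysics.StatisticalMechanics.inLayerInteraction (fun r => min 1 (max 0 (4 - 2 * r)) * Literature.MathematicalPhysics.StatisticalMechanics.lennardJones r) a = 6 * (min 1 (max 0 (4 - 2 * a)) * Literature.MathematicalPhysics.StatisticalMechanics.lennardJones a) + 6 * (min 1 (max 0 (4 - 2 * (√3 * a))) * Literature.MathematicalPhysics.StatisticalMechanics.lennardJones (√3 * a)) + 6 * (min 1 (max 0 (4 - 2 * (2 * a))) * Literature.MathematicalPhysics.StatisticalMechanics.lennardJones (2 * a)) ∧ Literature.MathematicalPhysics.StatisticalMechanics.layerInteraction (fun r => min 1 (max 0 (4 - 2 * r)) * Literature.MathematicalPhysics.StatisticalMechanics.lennardJones r) a h 1 1 = 3 * (min 1 (max 0 (4 - 2 * (√(a ^ 2 / 3 + h ^ 2)))) * Literature.MathematicalPhysics.StatisticalMechanics.lennardJones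 (√(a ^ 2 / 3 + h ^ 2))) + 3 * (min 1 (max 0 (4 - 2 * (√(4 * a ^ 2 / 3 + h ^ 2)))) * Literature.MathematicalPhysics.StatisticalMechanics.lennardJones (√(4 * a ^ 2 / 3 + h ^ 2))) + 6 * (min 1 (max 0 (4 - 2 * (√(7 * a ^ 2 / 3 + h ^ 2)))) * Literature.MathematicalPhysics.StatisticalMechanics.lennardJones (√(7 * a ^ 2 / 3 + h ^ 2))) ∧ Literature.MathematicalPhysics.StatisticalMechanics.layerInteraction (fun r => min 1 (max 0 (4 - 2 * r)) * Literature.MathematicalPhysics.StatisticalMechanics.lennardJones r) a h 1 2 = 3 * (min 1 (max 0 (4 - 2 * (√(a ^ 2 / 3 + 4 * h ^ 2)))) * Literature.MathematicalPhysics.StatisticalMechanics.lennardJones (√(a ^ 2 / 3 + 4 * h ^ 2))) + 3 * (min 1 (max 0 (4 - 2 * (√(4 * a ^ 2 / 3 + 4 * h ^ 2)))) * Literature.MathematicalPhysics.StatisticalMechanics.lennardJones (√(4 * a ^ 2 / 3 + 4 * h ^ 2))) ∧ Literature.MathematicalPhysics.StatisticalMechanics.layerInteraction (fun r => min 1 (max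 0 (4 - 2 * r)) * Literature.MathematicalPhysics.StatisticalMechanics.lennardJones r) a h 0 2 = (min 1 (max 0 (4 - 2 * (2 * h))) * Literature.MathematicalPhysics.StatisticalMechanics.lennardJones (2 * h)) + 6 * (min 1 (max 0 (4 - 2 * (√(a ^ 2 + 4 * h ^ 2)))) * Literature.MathematicalPhysics.StatisticalMechanics.lennardJones (√(a ^ 2 + 4 * h ^ 2))) ∧ Literature.MathematicalPhysics.StatisticalMechanics.barlowBaseEnergy (fun r => min 1 (max 0 (4 - 2 * r)) * Literature.MathematicalPhysics.StatisticalMechanics.lennardJones r) a h = 1 / 2 * Literature.MathematicalPhysics.StatisticalMechanics.inLayerInteraction (fun r => min 1 (max 0 (4 - 2 * r)) * Literature.MathematicalPhysics.StatisticalMechanics.lennardJones r) a + (Literature.MathematicalPhysics.StatisticalMechanics.layerInteraction (fun r => min 1 (max 0 (4 - 2 * r)) * Literature.MathematicalPhysics.StatisticalMechanics.lennardJones r) a h 1 1 + Literature.MathematicalPhysics.StatisticalMechanics.layerInteraction (fun r => min 1 (max 0 (4 - 2 * r)) * Literature.MathematicalPhysics.StatisticalMechanics.lennardJones r) a h 1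 2) :=
  Theorems.PricedLinkCensusTruncatedCensusGap.stub_barlowLayerSumsWindow

example : BarlowLayerSumsWindow := stub_barlowLayerSumsWindow

/-- **N1b `stub_strainedMarginCert` — LANDED** (p168897, lead c5; certified box computation
`Theorems/PricedLinkCensusTruncatedCensusGapStrainedMarginCert{Defs,Analysis,Checker,}.lean`,
p168514/p168654/p168782/p168897: rational checker run by `decide +kernel` + soundness). -/
theorem stub_strainedMarginCert :
    ∃ μ : ℝ, 0 < μ ∧ ∀ a h : ℝ, 93 / 100 ≤ a → a ≤ 51 / 50 → 78 / 100 * a ≤ h → h ≤ 86 / 100 * a → (h ≤ 808 / 1000 * a ∨ 825 / 1000 * a ≤ h) → 3 * (min 1 (max 0 (4 - 2 * (977 / 1000))) * Literature.MathematicalPhysics.StatisticalMechanics.lennardJones (977 / 1000)) + 3 * (min 1 (max 0 (4 - 2 * (√3 * (977 / 1000)))) * Literature.MathematicalPhysics.StatisticalMechanics.lennardJones (√3 * (977 / 1000))) + 3 * (min 1 (max 0 (4 - 2 * (2 * (977 / 1000)))) * Literature.MathematicalPhysics.StatisticalMechanics.lennardJones (2 * (977 / 1000))) + 3 * (min 1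 (max 0 (4 - 2 * (√((977 / 1000) ^ 2 / 3 + (797 / 1000) ^ 2)))) * Literature.MathematicalPhysics.StatisticalMechanics.lennardJones (√((977 / 1000) ^ 2 / 3 + (797 / 1000) ^ 2))) + 3 * (min 1 (max 0 (4 - 2 * (√(4 * (977 / 1000) ^ 2 / 3 + (797 / 1000) ^ 2)))) * Literature.MathematicalPhysics.StatisticalMechanics.lennardJones (√(4 * (977 / 1000) ^ 2 / 3 + (797 / 1000) ^ 2))) + 6 * (min 1 (max 0 (4 - 2 * (√(7 * (977 / 1000) ^ 2 / 3 + (797 / 1000) ^ 2)))) * Literature.MathematicalPhysics.StatisticalMechanics.lennardJones (√(7 * (977 / 1000) ^ 2 / 3 + (797 / 1000) ^ 2))) + (min 1 (max 0 (4 - 2 * (2 * (797 / 1000)))) * Literature.MathematicalPhysics.StatisticalMechanics.lennardJones (2 * (797 / 1000))) + 6 * (min 1 (max 0 (4 - 2 * (√((977 / 1000) ^ 2 + 4 * (797 / 1000) ^ 2)))) * Literature.MathematicalPhysics.StatisticalMechanics.lennardJones (√((977 / 1000) ^ 2 + 4 * (797 / 1000) ^ 2))) + μ ≤ min (3 * (min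 1 (max 0 (4 - 2 * a)) * Literature.MathematicalPhysics.StatisticalMechanics.lennardJones a) + 3 * (min 1 (max 0 (4 - 2 * (√3 * a))) * Literature.MathematicalPhysics.StatisticalMechanics.lennardJones (√3 * a)) + 3 * (min 1 (max 0 (4 - 2 * (2 * a))) * Literature.MathematicalPhysics.StatisticalMechanics.lennardJones (2 * a)) + 3 * (min 1 (max 0 (4 - 2 * (√(a ^ 2 / 3 + h ^ 2)))) * Literature.MathematicalPhysics.StatisticalMechanics.lennardJones (√(a ^ 2 / 3 + h ^ 2))) + 3 * (min 1 (max 0 (4 - 2 * (√(4 * a ^ 2 / 3 + h ^ 2)))) * Literature.MathematicalPhysics.StatisticalMechanics.lennardJones (√(4 * a ^ 2 / 3 + h ^ 2))) + 6 * (min 1 (max 0 (4 - 2 * (√(7 * a ^ 2 / 3 + h ^ 2)))) * Literature.MathematicalPhysics.StatisticalMechanics.lennardJones (√(7 * a ^ 2 / 3 + h ^ 2))) + 3 * (min 1 (max 0 (4 - 2 * (√(a ^ 2 / 3 + 4 * h ^ 2)))) * Literature.MathematicalPhysics.StatisticalMechanics.lennardJones (√(a ^ 2 / 3 + 4 * h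 ^ 2))) + 3 * (min 1 (max 0 (4 - 2 * (√(4 * a ^ 2 / 3 + 4 * h ^ 2)))) * Literature.MathematicalPhysics.StatisticalMechanics.lennardJones (√(4 * a ^ 2 / 3 + 4 * h ^ 2)))) (3 * (min 1 (max 0 (4 - 2 * a)) * Literature.MathematicalPhysics.StatisticalMechanics.lennardJones a) + 3 * (min 1 (max 0 (4 - 2 * (√3 * a))) * Literature.MathematicalPhysics.StatisticalMechanics.lennardJones (√3 * a)) + 3 * (min 1 (max 0 (4 - 2 * (2 * a))) * Literature.MathematicalPhysics.StatisticalMechanics.lennardJones (2 * a)) + 3 * (min 1 (max 0 (4 - 2 * (√(a ^ 2 / 3 + h ^ 2)))) * Literature.MathematicalPhysics.StatisticalMechanics.lennardJones (√(a ^ 2 / 3 + h ^ 2))) + 3 * (min 1 (max 0 (4 - 2 * (√(4 * a ^ 2 / 3 + h ^ 2)))) * Literature.MathematicalPhysics.StatisticalMechanics.lennardJones (√(4 * a ^ 2 / 3 + h ^ 2))) + 6 * (min 1 (max 0 (4 - 2 * (√(7 * a ^ 2 / 3 + h ^ 2)))) * Literature.MathematicalPhysics.StatisticalMechanics.lennardJones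 (√(7 * a ^ 2 / 3 + h ^ 2))) + (min 1 (max 0 (4 - 2 * (2 * h))) * Literature.MathematicalPhysics.StatisticalMechanics.lennardJones (2 * h)) + 6 * (min 1 (max 0 (4 - 2 * (√(a ^ 2 + 4 * h ^ 2)))) * Literature.MathematicalPhysics.StatisticalMechanics.lennardJones (√(a ^ 2 + 4 * h ^ 2)))) :=
  Theorems.PricedLinkCensusTruncatedCensusGap.stub_strainedMarginCert

example : StrainedMarginCert := stub_strainedMarginCert

/-- **N1 from N1a + N1b** (reshape r1, proved): for a periodic Barlow word in the strained
window, `e(word) = e₀ + J₂ · α`, `α = alignedFrequency s p 2 ∈ [0, 1]` (affine stacking law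
p129223 + energy identity p129723), so `e(word) ≥ min (F_fcc, F_hcp) ≥ F_hcp(a₀,h₀) + μ`
(N1a, N1b) `= e(hcp a₀ h₀) + μ ≥ e_χ* + μ` (`ciInf_le` under `stub_periodicStability`). -/
theorem strainedBarlowMargin_of_cert (hA : BarlowLayerSumsWindow) (hB : StrainedMarginCert) :
    StrainedBarlowMargin := by
  obtain ⟨μ, hμ, hcert⟩ := hB
  refine ⟨μ, hμ, ?_⟩
  intro a h s p ha hh hp hs ha1 ha2 hh1 hh2 hstr hhagg
  have ha0 : 0 < a := by linarith
  have hh0 : 0 < h := by linarith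
  have h3 : 2 ≤ 3 * h := by linarith
  -- the word: `e(word) = e₀(a,h) + J₂(a,h) · α`
  have hword : (barlowPeriodicConfiguration s ha hh hp hs).energyPerParticle (fun r => min 1 (max 0 (4 - 2 * r)) * lennardJones r) =
      barlowBaseEnergy (fun r => min 1 (max 0 (4 - 2 * r)) * lennardJones r) a h + barlowCoupling (fun r => min 1 (max 0 (4 - 2 * r)) * lennardJones r) a h 2 * alignedFrequency s p 2 := by
    rw [Theorems.PricedLinkCensusTruncatedCensusGap.energyPerParticle_barlow_truncLJ_eq_average
      a h s p ha hh hp hs ha0 hh0, div_eq_inv_mul]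
    exact Theorems.PricedLinkCensusTruncatedCensusGap.barlowSiteEnergy_average_truncLJ_affine
      a h s p ha0 h3 hhagg hp hs
  -- the reference: `e(hcp a₀ h₀) = e₀(a₀,h₀) + J₂(a₀,h₀)`, and `e_χ* ≤ e(hcp a₀ h₀)`
  have ha0' : (977 / 1000 : ℝ) ≠ 0 := by norm_num
  have hh0' : (797 / 1000 : ℝ) ≠ 0 := by norm_num
  have href : (hcpPeriodicConfiguration ha0' hh0').energyPerParticle (fun r => min 1 (max 0 (4 - 2 * r)) * lennardJones r) =
      barlowBaseEnergy (fun r => min 1 (max 0 (4 - 2 * r)) * lennardJones r) (977 / 1000) (797 / 1000) +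
        barlowCoupling (fun r => min 1 (max 0 (4 - 2 * r)) * lennardJones r) (977 / 1000) (797 / 1000) 2 := by
    show (barlowPeriodicConfiguration alternatingHagg ha0' hh0' two_ne_zero
      alternatingHagg_periodic).energyPerParticle (fun r => min 1 (max 0 (4 - 2 * r)) * lennardJones r) = _
    rw [Theorems.PricedLinkCensusTruncatedCensusGap.energyPerParticle_barlow_truncLJ_eq_average
        (977 / 1000) (797 / 1000) alternatingHagg 2 ha0' hh0' two_ne_zero alternatingHagg_periodic
        (by norm_num) (by norm_num),
      div_eq_inv_mul,
      Theorems.PricedLinkCensusTruncatedCensusGap.barlowSiteEnergy_average_truncLJ_affine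
        (977 / 1000) (797 / 1000) alternatingHagg 2 (by norm_num) (by norm_num) isHaggSeq_alternating
        two_ne_zero alternatingHagg_periodic,
      Theorems.PricedLinkCensusTruncatedCensusGap.alignedFrequency_alternatingHagg_two_two, mul_one]
  have hstar : (⨅ Q : PeriodicConfiguration 3, Q.energyPerParticle (fun r => min 1 (max 0 (4 - 2 * r)) * lennardJones r)) ≤
      (hcpPeriodicConfiguration ha0' hh0').energyPerParticle (fun r => min 1 (max 0 (4 - 2 * r)) * lennardJones r) :=
    ciInf_le Theorems.PricedLinkCensusTruncatedCensusGap.stub_periodicStability _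
  -- the layer sums at `(a, h)` and at the reference, the certificate at `(a, h)`
  obtain ⟨hin, h11, h12, h02, hbase⟩ := hA a h ha1 (by linarith)
  obtain ⟨hin', h11', h12', h02', hbase'⟩ := hA (977 / 1000) (797 / 1000) (by norm_num) (by norm_num)
  obtain ⟨hc1, hc2⟩ := le_min_iff.1 (hcert a h ha1 ha2 hh1 hh2 hstr)
  have hα0 : 0 ≤ alignedFrequency s p 2 := by unfold alignedFrequency; positivity
  have hα1 := Theorems.PricedLinkCensusTruncatedCensusGap.alignedFrequency_le_one s p 2
  -- `e₀(a,h) = F_fcc(a,h)`, `e₀ + J₂ = F_hcp`, at `(a,h)` and at the reference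
  have he0 : barlowBaseEnergy (fun r => min 1 (max 0 (4 - 2 * r)) * lennardJones r) a h =
      3 * (min 1 (max 0 (4 - 2 * a)) * lennardJones a) + 3 * (min 1 (max 0 (4 - 2 * (√3 * a))) * lennardJones (√3 * a)) + 3 * (min 1 (max 0 (4 - 2 * (2 * a))) * lennardJones (2 * a)) + 3 * (min 1 (max 0 (4 - 2 * (√(a ^ 2 / 3 + h ^ 2)))) * lennardJones (√(a ^ 2 / 3 + h ^ 2))) + 3 * (min 1 (max 0 (4 - 2 * (√(4 * a ^ 2 / 3 + h ^ 2)))) * lennardJones (√(4 * a ^ 2 / 3 + h ^ 2))) + 6 * (min 1 (max 0 (4 - 2 * (√(7 * a ^ 2 / 3 + h ^ 2)))) * lennardJones (√(7 * a ^ 2 / 3 + h ^ 2))) + 3 * (min 1 (max 0 (4 - 2 * (√(a ^ 2 / 3 + 4 * h ^ 2)))) * lennardJones (√(a ^ 2 / 3 + 4 * h ^ 2))) + 3 * (min 1 (max 0 (4 - 2 * (√(4 * a ^ 2 / 3 + 4 * h ^ 2)))) * lennardJones (√(4 * a ^ 2 / 3 + 4 * h ^ 2))) := by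
    rw [hbase, hin, h11, h12]; ring
  have heJ : barlowBaseEnergy (fun r => min 1 (max 0 (4 - 2 * r)) * lennardJones r) a h + barlowCoupling (fun r => min 1 (max 0 (4 - 2 * r)) * lennardJones r) a h 2 =
      3 * (min 1 (max 0 (4 - 2 * a)) * lennardJones a) + 3 * (min 1 (max 0 (4 - 2 * (√3 * a))) * lennardJones (√3 * a)) + 3 * (min 1 (max 0 (4 - 2 * (2 * a))) * lennardJones (2 * a)) + 3 * (min 1 (max 0 (4 - 2 * (√(a ^ 2 / 3 + h ^ 2)))) * lennardJones (√(a ^ 2 / 3 + h ^ 2))) + 3 * (min 1 (max 0 (4 - 2 * (√(4 * a ^ 2 / 3 + h ^ 2)))) * lennardJones (√(4 * a ^ 2 / 3 + h ^ 2))) + 6 * (min 1 (max 0 (4 - 2 * (√(7 * a ^ 2 / 3 + h ^ 2)))) * lennardJones (√(7 * a ^ 2 / 3 + h ^ 2))) + (min 1 (max 0 (4 - 2 * (2 * h))) * lennardJones (2 * h)) + 6 * (min 1 (max 0 (4 - 2 * (√(a ^ 2 + 4 * h ^ 2)))) * lennardJones (√(a ^ 2 + 4 * h ^ 2))) := by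
    rw [barlowCoupling, hbase, hin, h11]; push_cast; rw [h02, h12]; ring
  have heR : barlowBaseEnergy (fun r => min 1 (max 0 (4 - 2 * r)) * lennardJones r) (977 / 1000) (797 / 1000) +
      barlowCoupling (fun r => min 1 (max 0 (4 - 2 * r)) * lennardJones r) (977 / 1000) (797 / 1000) 2 =
      3 * (min 1 (max 0 (4 - 2 * (977 / 1000))) * lennardJones (977 / 1000)) + 3 * (min 1 (max 0 (4 - 2 * (√3 * (977 / 1000)))) * lennardJones (√3 * (977 / 1000))) + 3 * (min 1 (max 0 (4 - 2 * (2 * (977 / 1000)))) * lennardJones (2 * (977 / 1000))) + 3 * (min 1 (max 0 (4 - 2 * (√((977 / 1000) ^ 2 / 3 + (797 / 1000) ^ 2)))) * lennardJones (√((977 / 1000) ^ 2 / 3 + (797 / 1000) ^ 2))) + 3 * (min 1 (max 0 (4 - 2 * (√(4 * (977 / 1000) ^ 2 / 3 + (797 / 1000) ^ 2)))) * lennardJones (√(4 * (977 / 1000) ^ 2 / 3 + (797 / 1000) ^ 2))) + 6 * (min 1 (max 0 (4 - 2 * (√(7 * (977 / 1000) ^ 2 / 3 + (797 / 1000) ^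 2)))) * lennardJones (√(7 * (977 / 1000) ^ 2 / 3 + (797 / 1000) ^ 2))) + (min 1 (max 0 (4 - 2 * (2 * (797 / 1000)))) * lennardJones (2 * (797 / 1000))) + 6 * (min 1 (max 0 (4 - 2 * (√((977 / 1000) ^ 2 + 4 * (797 / 1000) ^ 2)))) * lennardJones (√((977 / 1000) ^ 2 + 4 * (797 / 1000) ^ 2))) := by
    rw [barlowCoupling, hbase', hin', h11']; push_cast; rw [h02', h12']; ring
  have hc1' : (hcpPeriodicConfiguration ha0' hh0').energyPerParticle (fun r => min 1 (max 0 (4 - 2 * r)) * lennardJones r) + μ ≤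
      barlowBaseEnergy (fun r => min 1 (max 0 (4 - 2 * r)) * lennardJones r) a h := by
    rw [href, heR, he0]; exact hc1
  have hc2' : (hcpPeriodicConfiguration ha0' hh0').energyPerParticle (fun r => min 1 (max 0 (4 - 2 * r)) * lennardJones r) + μ ≤
      barlowBaseEnergy (fun r => min 1 (max 0 (4 - 2 * r)) * lennardJones r) a h + barlowCoupling (fun r => min 1 (max 0 (4 - 2 * r)) * lennardJones r) a h 2 := by
    rw [href, heR, heJ]; exact hc2
  rw [hword]
  rcases le_total 0 (barlowCoupling (fun r => min 1 (max 0 (4 - 2 * r)) * lennardJones r) a h 2) with hJ | hJ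
  · have hJα := mul_nonneg hJ hα0
    linarith
  · have hJα := mul_le_mul_of_nonpos_left hα1 hJ
    rw [mul_one] at hJα
    linarith

/-- **N1 `StrainedBarlowMargin` HOLDS** (sorry-free: N1a p167941 + N1b p168897 + the glue). -/
theorem strainedBarlowMargin_holds : StrainedBarlowMargin :=
  strainedBarlowMargin_of_cert stub_barlowLayerSumsWindow stub_strainedMarginCert

/-- **STUB (N2′)** `stub_localNearPricing` — THE NEAR HALF'S OPEN CORE (reshape r2): chart-free local
pricing of deep-near sites with zero-sum bounded transfers.  Inputs/evidence for any future proof: N1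
(`strainedBarlowMargin`, PROVED p169296), the landscape package N1c (lead's certificate lane), the free-patch
harmonic data (+0.040…+0.93 modulo rigid motions, no negative direction), the lever lemma (PLAN-N3 S5). -/
theorem stub_localNearPricing :
    ∃ κ C ρ : ℝ, 0 < κ ∧ ∃ F : (N : ℕ) → (Fin N → EuclideanSpace ℝ (Fin 3)) → Fin N → ℝ, (∀ (N : ℕ) (y : Fin N → EuclideanSpace ℝ (Fin 3)), Function.Injective y → ∑ i, F N y i = 0) ∧ (∀ (N : ℕ) (y : Fin N → EuclideanSpace ℝ (Fin 3)) (i : Fin N), Function.Injective y → |F N y i| ≤ C) ∧ ∀ (N : ℕ) (y : Fin N → EuclideanSpace ℝ (Fin 3)) (i : Fin N), Function.Injective y → (∀ i' : Fin N, dist (y i') (y i) ≤ ρ → ∃ (a c : ℝ) (s : ℤ → ℤ) (g : EuclideanSpace ℝ (Fin 3) ≃ᵃⁱ[ℝ] EuclideanSpace ℝ (Fin 3)), 93 / 100 ≤ a ∧ a ≤ 51 / 50 ∧ 78 / 100 * a ≤ c ∧ c ≤ 86 / 100 * a ∧ Literature.MathematicalPhysics.StatisticalMechanics.IsHaggSeq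 s ∧ (∀ j k : Fin N, j ≠ k → dist (y j) (y i') ≤ 3 * a → a / 2 ≤ dist (y j) (y k)) ∧ (∀ j : Fin N, dist (y j) (y i') ≤ 3 * a → ∃ z ∈ Literature.MathematicalPhysics.StatisticalMechanics.barlowStacking a c s, dist (y j) (g z) ≤ a / 50) ∧ (∀ z ∈ Literature.MathematicalPhysics.StatisticalMechanics.barlowStacking a c s, dist (g z) (y i') ≤ 3 * a → ∃ j : Fin N, dist (y j) (g z) ≤ a / 50)) → (⨅ Q : Literature.MathematicalPhysics.StatisticalMechanics.PeriodicConfiguration 3, Q.energyPerParticle (fun r => min 1 (max 0 (4 - 2 * r)) * Literature.MathematicalPhysics.StatisticalMechanics.lennardJones r)) ≤ Literature.MathematicalPhysics.StatisticalMechanics.siteEnergy (fun r => min 1 (max 0 (4 - 2 * r)) * Literature.MathematicalPhysics.StatisticalMechanics.lennardJones r) y i / 2 + F N y i ∧ (¬ Literature.Geometry.DiscreteGeometry.IsChargeFree (1 / 100 : ℝ) y i → (⨅ Q : Literature.MathematicalPhysics.StatisticalMechanics.PeriodicConfiguration 3, Q.energyPerParticle (fun r => min 1 (max 0 (4 - 2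 * r)) * Literature.MathematicalPhysics.StatisticalMechanics.lennardJones r)) + κ ≤ Literature.MathematicalPhysics.StatisticalMechanics.siteEnergy (fun r => min 1 (max 0 (4 - 2 * r)) * Literature.MathematicalPhysics.StatisticalMechanics.lennardJones r) y i / 2 + F N y i) := by
  sorry

example : LocalNearPricing := stub_localNearPricing

/-- **N3′ `stub_nearOfLocalPricing` — LANDED** (p169781, stub-worker of lead c5, wave 2;
`Theorems/PricedLinkCensusTruncatedCensusGapNearOfLocalPricing.lean`, 358 lines: superstability floor for far
sites, deep/shallow split by packing, `e_χ* ≤ 0`, Finset assembly; `C' = (κ + 37 + max C 0)·(400·max ρ 0/93 + 1)³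
+ max C 0 + 205`). -/
theorem stub_nearOfLocalPricing :
    (∃ κ C ρ : ℝ, 0 < κ ∧ ∃ F : (N : ℕ) → (Fin N → EuclideanSpace ℝ (Fin 3)) → Fin N → ℝ, (∀ (N : ℕ) (y : Fin N → EuclideanSpace ℝ (Fin 3)), Function.Injective y → ∑ i, F N y i = 0) ∧ (∀ (N : ℕ) (y : Fin N → EuclideanSpace ℝ (Fin 3)) (i : Fin N), Function.Injective y → |F N y i| ≤ C) ∧ ∀ (N : ℕ) (y : Fin N → EuclideanSpace ℝ (Fin 3)) (i : Fin N), Function.Injective y → (∀ i' : Fin N, dist (y i') (y i) ≤ ρ → ∃ (a c : ℝ) (s : ℤ → ℤ) (g : EuclideanSpace ℝ (Fin 3) ≃ᵃⁱ[ℝ] EuclideanSpace ℝ (Fin 3)), 93 / 100 ≤ a ∧ a ≤ 51 / 50 ∧ 78 / 100 * a ≤ c ∧ c ≤ 86 / 100 * a ∧ Literature.MathematicalPhysics.StatisticalMechanics.IsHaggSeq s ∧ (∀ j k : Fin N, j ≠ k → dist (y j) (y i') ≤ 3 * a → a / 2 ≤ dist (y j) (y k)) ∧ (∀ j : Fin N,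 dist (y j) (y i') ≤ 3 * a → ∃ z ∈ Literature.MathematicalPhysics.StatisticalMechanics.barlowStacking a c s, dist (y j) (g z) ≤ a / 50) ∧ (∀ z ∈ Literature.MathematicalPhysics.StatisticalMechanics.barlowStacking a c s, dist (g z) (y i') ≤ 3 * a → ∃ j : Fin N, dist (y j) (g z) ≤ a / 50)) → (⨅ Q : Literature.MathematicalPhysics.StatisticalMechanics.PeriodicConfiguration 3, Q.energyPerParticle (fun r => min 1 (max 0 (4 - 2 * r)) * Literature.MathematicalPhysics.StatisticalMechanics.lennardJones r)) ≤ Literature.MathematicalPhysics.StatisticalMechanics.siteEnergy (fun r => min 1 (max 0 (4 - 2 * r)) * Literature.MathematicalPhysics.StatisticalMechanics.lennardJones r) y i / 2 + F N y i ∧ (¬ Literature.Geometry.DiscreteGeometry.IsChargeFree (1 / 100 : ℝ) y i → (⨅ Q : Literature.MathematicalPhysics.StatisticalMechanics.PeriodicConfiguration 3, Q.energyPerParticle (fun r => min 1 (max 0 (4 - 2 * r)) * Literature.MathematicalPhysics.StatisticalMechanics.lennardJones r)) + κ ≤ Literature.MathematicalPhysics.StatisticalMechanics.siteEnergy (fun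 r => min 1 (max 0 (4 - 2 * r)) * Literature.MathematicalPhysics.StatisticalMechanics.lennardJones r) y i / 2 + F N y i)) → (∃ κ C : ℝ, 0 < κ ∧ ∀ (N : ℕ) (y : Fin N → EuclideanSpace ℝ (Fin 3)), Function.Injective y → ∀ S : Finset (Fin N), (∀ i : Fin N, i ∈ S ↔ ∃ (a c : ℝ) (s : ℤ → ℤ) (g : EuclideanSpace ℝ (Fin 3) ≃ᵃⁱ[ℝ] EuclideanSpace ℝ (Fin 3)), 93 / 100 ≤ a ∧ a ≤ 51 / 50 ∧ 78 / 100 * a ≤ c ∧ c ≤ 86 / 100 * a ∧ Literature.MathematicalPhysics.StatisticalMechanics.IsHaggSeq s ∧ (∀ j k : Fin N, j ≠ k → dist (y j) (y i) ≤ 3 * a → a / 2 ≤ dist (y j) (y k)) ∧ (∀ j : Fin N, dist (y j) (y i) ≤ 3 * a → ∃ z ∈ Literature.MathematicalPhysics.StatisticalMechanics.barlowStacking a c s, dist (y j) (g z) ≤ a / 50) ∧ (∀ z ∈ Literature.MathematicalPhysics.StatisticalMechanics.barlowStacking a c s, dist (g z) (y i) ≤ 3 * a → ∃ j : Fin N,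 dist (y j) (g z) ≤ a / 50)) → (N : ℝ) * (⨅ Q : Literature.MathematicalPhysics.StatisticalMechanics.PeriodicConfiguration 3, Q.energyPerParticle (fun r => min 1 (max 0 (4 - 2 * r)) * Literature.MathematicalPhysics.StatisticalMechanics.lennardJones r)) + κ * (Nat.card {i : Fin N // ¬ Literature.Geometry.DiscreteGeometry.IsChargeFree (1 / 100 : ℝ) y i ∧ i ∈ S} : ℝ) ≤ Literature.MathematicalPhysics.StatisticalMechanics.interactionEnergy (fun r => min 1 (max 0 (4 - 2 * r)) * Literature.MathematicalPhysics.StatisticalMechanics.lennardJones r) y + C * ((Finset.univ \ S).card : ℝ)) :=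
  Theorems.PricedLinkCensusTruncatedCensusGap.stub_nearOfLocalPricing

example : LocalNearPricing → NearBarlowChargePricing' := stub_nearOfLocalPricing


/-! ## §3 Name-keyed aliases (hypotheses of the composition) -/
namespace Registered

/-- Alias keyed by the registered stub name. -/
abbrev stub_barlowFarSiteGap : Prop := BarlowFarSiteGap
/-- Alias keyed by the registered stub name. -/
abbrev stub_localNearPricing : Prop := LocalNearPricing

end Registered

/-! ## §4 Proved glue (sorry-free) -/

/-- **The near/far glue**: FAR and NEAR give the crux with `κ := κ₁κ₂/(κ₁ + κ₂ + max C 0)`. -/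
theorem truncatedCensusGap_of_nearFarSplit (hFar' : BarlowFarSiteGap)
    (hNear' : NearBarlowChargePricing) : TruncatedCensusGap := by
  obtain ⟨κ₂, hκ₂, hFar⟩ := hFar'
  obtain ⟨κ₁, C, hκ₁, hNear⟩ := hNear'
  -- the price
  set C' : ℝ := max C 0 with hC'
  have hC'0 : 0 ≤ C' := le_max_right _ _
  have hCC' : C ≤ C' := le_max_left _ _
  have hS : 0 < κ₁ + κ₂ + C' := by linarith
  refine ⟨κ₁ * κ₂ / (κ₁ + κ₂ + C'), div_pos (mul_pos hκ₁ hκ₂) hS, fun N y hy => ?_⟩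
  have e1 := hFar N y hy
  have e2 := hNear N y hy
  -- abbreviations
  set E : ℝ := Literature.MathematicalPhysics.StatisticalMechanics.interactionEnergy (fun r => min 1 (max 0 (4 - 2 * r)) * Literature.MathematicalPhysics.StatisticalMechanics.lennardJones r) y with hE
  set estar : ℝ := (⨅ Q : Literature.MathematicalPhysics.StatisticalMechanics.PeriodicConfiguration 3, Q.energyPerParticle (fun r => min 1 (max 0 (4 - 2 * r)) * Literature.MathematicalPhysics.StatisticalMechanics.lennardJones r)) with hestar
  set near : Fin N → Prop := fun i => ∃ (a c : ℝ) (s : ℤ → ℤ) (g : EuclideanSpace ℝ (Fin 3) ≃ᵃⁱ[ℝ] EuclideanSpace ℝ (Fin 3)), 93 / 100 ≤ a ∧ a ≤ 51 / 50 ∧ 78 / 100 * a ≤ c ∧ c ≤ 86 / 100 * a ∧ Literature.MathematicalPhysics.StatisticalMechanics.IsHaggSeq s ∧ (∀ j k : Fin N, j ≠ k → dist (y j) (y i) ≤ 3 * a → a / 2 ≤ dist (y j) (y k)) ∧ (∀ j : Fin N, dist (y j) (y i) ≤ 3 * a → ∃ z ∈ Literature.MathematicalPhysics.StatisticalMechanics.barlowStacking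 a c s, dist (y j) (g z) ≤ a / 50) ∧ (∀ z ∈ Literature.MathematicalPhysics.StatisticalMechanics.barlowStacking a c s, dist (g z) (y i) ≤ 3 * a → ∃ j : Fin N, dist (y j) (g z) ≤ a / 50) with hnear
  -- the three finsets
  set Ch := Finset.univ.filter fun i : Fin N => ¬ IsChargeFree (1 / 100 : ℝ) y i with hCh
  set Fr := Finset.univ.filter fun i : Fin N => ¬ near i with hFr
  set Nc := Finset.univ.filter fun i : Fin N => ¬ IsChargeFree (1 / 100 : ℝ) y i ∧ near i with hNc
  have hChNat : (Nat.card {i : Fin N // ¬ IsChargeFree (1 / 100 : ℝ) y i} : ℝ) = Ch.card := by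
    rw [Nat.card_eq_fintype_card, Fintype.card_subtype]
  have hFrNat : (Nat.card {i : Fin N // ¬ near i} : ℝ) = Fr.card := by
    rw [Nat.card_eq_fintype_card, Fintype.card_subtype]
  have hNcNat : (Nat.card {i : Fin N // ¬ IsChargeFree (1 / 100 : ℝ) y i ∧ near i} : ℝ) = Nc.card := by
    rw [Nat.card_eq_fintype_card, Fintype.card_subtype]
  -- (1) a charged site is near-and-charged or far
  have hcover : Ch ⊆ Nc ∪ Fr := by
    intro i hi
    have hci : ¬ IsChargeFree (1 / 100 : ℝ) y i := (Finset.mem_filter.1 hi).2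
    by_cases hn : near i
    · exact Finset.mem_union_left _ (Finset.mem_filter.2 ⟨Finset.mem_univ _, hci, hn⟩)
    · exact Finset.mem_union_right _ (Finset.mem_filter.2 ⟨Finset.mem_univ _, hn⟩)
  have hcard : (Ch.card : ℝ) ≤ Nc.card + Fr.card := by
    exact_mod_cast (Finset.card_le_card hcover).trans (Finset.card_union_le Nc Fr)
  -- (2) the two hypotheses in finset form
  change (N : ℝ) * estar + κ₂ * (Nat.card {i : Fin N // ¬ near i} : ℝ) ≤ E at e1
  change (N : ℝ) * estar + κ₁ * (Nat.card {i : Fin N // ¬ IsChargeFree (1 / 100 : ℝ) y i ∧ near i} : ℝ)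
      ≤ E + C * (Nat.card {i : Fin N // ¬ near i} : ℝ) at e2
  rw [hFrNat] at e1
  rw [hNcNat, hFrNat] at e2
  change (N : ℝ) * estar + κ₁ * κ₂ / (κ₁ + κ₂ + C') *
      (Nat.card {i : Fin N // ¬ IsChargeFree (1 / 100 : ℝ) y i} : ℝ) ≤ E
  rw [hChNat]
  have hF0 : (0 : ℝ) ≤ Fr.card := Nat.cast_nonneg _
  have hN0 : (0 : ℝ) ≤ Nc.card := Nat.cast_nonneg _
  have hX1 : κ₂ * (Fr.card : ℝ) ≤ E - N * estar := by linarith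
  have hX2 : κ₁ * (Nc.card : ℝ) ≤ (E - N * estar) + C' * Fr.card := by
    have : C * (Fr.card : ℝ) ≤ C' * Fr.card := mul_le_mul_of_nonneg_right hCC' hF0
    linarith
  have key : κ₁ * κ₂ * (Ch.card : ℝ) ≤ (κ₁ + κ₂ + C') * (E - N * estar) := by
    have a1 : κ₁ * κ₂ * (Ch.card : ℝ) ≤ κ₁ * κ₂ * (Nc.card + Fr.card) :=
      mul_le_mul_of_nonneg_left hcard (mul_pos hκ₁ hκ₂).le
    have a2 : κ₂ * (κ₁ * (Nc.card : ℝ)) ≤ κ₂ * ((E - N * estar) + C' * Fr.card) :=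
      mul_le_mul_of_nonneg_left hX2 hκ₂.le
    have a3 : κ₁ * (κ₂ * (Fr.card : ℝ)) ≤ κ₁ * (E - N * estar) :=
      mul_le_mul_of_nonneg_left hX1 hκ₁.le
    have a4 : C' * (κ₂ * (Fr.card : ℝ)) ≤ C' * (E - N * estar) :=
      mul_le_mul_of_nonneg_left hX1 hC'0
    nlinarith
  have hfin : κ₁ * κ₂ / (κ₁ + κ₂ + C') * (Ch.card : ℝ) ≤ E - N * estar := by
    rw [div_mul_eq_mul_div, div_le_iff₀ hS]
    linarith
  linarith

/-- **NEAR′ ⇒ NEAR** (reshape r2, proved): instantiate the `Finset` with the filter of the near predicate. -/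
theorem nearBarlowChargePricing_of_prime (h : NearBarlowChargePricing') : NearBarlowChargePricing := by
  obtain ⟨κ, C, hκ, h⟩ := h
  refine ⟨κ, max C 0, hκ, fun N y hy => ?_⟩
  set S : Finset (Fin N) := Finset.univ.filter fun i => ∃ (a c : ℝ) (s : ℤ → ℤ) (g : EuclideanSpace ℝ (Fin 3) ≃ᵃⁱ[ℝ] EuclideanSpace ℝ (Fin 3)), 93 / 100 ≤ a ∧ a ≤ 51 / 50 ∧ 78 / 100 * a ≤ c ∧ c ≤ 86 / 100 * a ∧ Literature.MathematicalPhysics.StatisticalMechanics.IsHaggSeq s ∧ (∀ j k : Fin N, j ≠ k → dist (y j) (y i) ≤ 3 * a → a / 2 ≤ dist (y j) (y k)) ∧ (∀ j : Fin N, dist (y j) (y i) ≤ 3 * a → ∃ z ∈ Literature.MathematicalPhysics.StatisticalMechanics.barlowStacking a c s, dist (y j) (g z) ≤ a / 50) ∧ (∀ z ∈ Literature.MathematicalPhysics.StatisticalMechanics.barlowStacking a c s, dist (g z) (y i) ≤ 3 * a → ∃ j : Fin N, dist (y j) (g z) ≤ a / 50) with hS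
  have hmem : ∀ i : Fin N, i ∈ S ↔ ∃ (a c : ℝ) (s : ℤ → ℤ) (g : EuclideanSpace ℝ (Fin 3) ≃ᵃⁱ[ℝ] EuclideanSpace ℝ (Fin 3)), 93 / 100 ≤ a ∧ a ≤ 51 / 50 ∧ 78 / 100 * a ≤ c ∧ c ≤ 86 / 100 * a ∧ Literature.MathematicalPhysics.StatisticalMechanics.IsHaggSeq s ∧ (∀ j k : Fin N, j ≠ k → dist (y j) (y i) ≤ 3 * a → a / 2 ≤ dist (y j) (y k)) ∧ (∀ j : Fin N, dist (y j) (y i) ≤ 3 * a → ∃ z ∈ Literature.MathematicalPhysics.StatisticalMechanics.barlowStacking a c s, dist (y j) (g z) ≤ a / 50) ∧ (∀ z ∈ Literature.MathematicalPhysics.StatisticalMechanics.barlowStacking a c s, dist (g z) (y i) ≤ 3 * a → ∃ j : Fin N, dist (y j) (g z) ≤ a / 50) := fun i => by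
    rw [hS, Finset.mem_filter]; simp
  have h1 := h N y hy S hmem
  have e1 : (Nat.card {i : Fin N // ¬ Literature.Geometry.DiscreteGeometry.IsChargeFree (1 / 100 : ℝ) y i ∧ i ∈ S} : ℝ) =
      (Nat.card {i : Fin N // ¬ Literature.Geometry.DiscreteGeometry.IsChargeFree (1 / 100 : ℝ) y i ∧ ∃ (a c : ℝ) (s : ℤ → ℤ) (g : EuclideanSpace ℝ (Fin 3) ≃ᵃⁱ[ℝ] EuclideanSpace ℝ (Fin 3)), 93 / 100 ≤ a ∧ a ≤ 51 / 50 ∧ 78 / 100 * a ≤ c ∧ c ≤ 86 / 100 * a ∧ Literature.MathematicalPhysics.StatisticalMechanics.IsHaggSeq s ∧ (∀ j k : Fin N, j ≠ k → dist (y j) (y i) ≤ 3 * a → a / 2 ≤ dist (y j) (y k)) ∧ (∀ j : Fin N, dist (y j) (y i) ≤ 3 * a → ∃ z ∈ Literature.MathematicalPhysics.StatisticalMechanics.barlowStacking a c s, dist (y j) (g z) ≤ a / 50) ∧ (∀ z ∈ Literature.MathematicalPhysics.StatisticalMechanics.barlowStacking a c s, dist (g z) (y i) ≤ 3 * a → ∃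 j : Fin N, dist (y j) (g z) ≤ a / 50)} : ℝ) := by
    congr 1
    exact Nat.card_congr (Equiv.subtypeEquivRight fun i => by rw [hmem])
  have e2 : ((Finset.univ \ S).card : ℝ) = (Nat.card {i : Fin N // ¬ ∃ (a c : ℝ) (s : ℤ → ℤ) (g : EuclideanSpace ℝ (Fin 3) ≃ᵃⁱ[ℝ] EuclideanSpace ℝ (Fin 3)), 93 / 100 ≤ a ∧ a ≤ 51 / 50 ∧ 78 / 100 * a ≤ c ∧ c ≤ 86 / 100 * a ∧ Literature.MathematicalPhysics.StatisticalMechanics.IsHaggSeq s ∧ (∀ j k : Fin N, j ≠ k → dist (y j) (y i) ≤ 3 * a → a / 2 ≤ dist (y j) (y k)) ∧ (∀ j : Fin N, dist (y j) (y i) ≤ 3 * a → ∃ z ∈ Literature.MathematicalPhysics.StatisticalMechanics.barlowStacking a c s, dist (y j) (g z) ≤ a / 50) ∧ (∀ z ∈ Literature.MathematicalPhysics.StatisticalMechanics.barlowStacking a c s, dist (g z) (y i) ≤ 3 * a → ∃ j : Fin N, dist (y j) (g z) ≤ a / 50)} : ℝ) := by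
    rw [Nat.card_eq_fintype_card, Fintype.card_subtype]
    congr 1
    congr 1
    ext i
    simp only [Finset.mem_sdiff, Finset.mem_univ, true_and, Finset.mem_filter]
    rw [hmem]
  rw [e1, e2] at h1
  have hc : C * (Nat.card {i : Fin N // ¬ ∃ (a c : ℝ) (s : ℤ → ℤ) (g : EuclideanSpace ℝ (Fin 3) ≃ᵃⁱ[ℝ] EuclideanSpace ℝ (Fin 3)), 93 / 100 ≤ a ∧ a ≤ 51 / 50 ∧ 78 / 100 * a ≤ c ∧ c ≤ 86 / 100 * a ∧ Literature.MathematicalPhysics.StatisticalMechanics.IsHaggSeq s ∧ (∀ j k : Fin N, j ≠ k → dist (y j) (y i) ≤ 3 * a → a / 2 ≤ dist (y j) (y k)) ∧ (∀ j : Fin N, dist (y j) (y i) ≤ 3 * a → ∃ z ∈ Literature.MathematicalPhysics.StatisticalMechanics.barlowStacking a c s, dist (y j) (g z) ≤ a / 50) ∧ (∀ z ∈ Literature.MathematicalPhysics.StatisticalMechanics.barlowStacking a c s, dist (g z) (y i) ≤ 3 * a → ∃ j : Fin N, dist (y j) (g z) ≤ a / 50)} : ℝ) ≤ max C 0 * (Nat.card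 {i : Fin N // ¬ ∃ (a c : ℝ) (s : ℤ → ℤ) (g : EuclideanSpace ℝ (Fin 3) ≃ᵃⁱ[ℝ] EuclideanSpace ℝ (Fin 3)), 93 / 100 ≤ a ∧ a ≤ 51 / 50 ∧ 78 / 100 * a ≤ c ∧ c ≤ 86 / 100 * a ∧ Literature.MathematicalPhysics.StatisticalMechanics.IsHaggSeq s ∧ (∀ j k : Fin N, j ≠ k → dist (y j) (y i) ≤ 3 * a → a / 2 ≤ dist (y j) (y k)) ∧ (∀ j : Fin N, dist (y j) (y i) ≤ 3 * a → ∃ z ∈ Literature.MathematicalPhysics.StatisticalMechanics.barlowStacking a c s, dist (y j) (g z) ≤ a / 50) ∧ (∀ z ∈ Literature.MathematicalPhysics.StatisticalMechanics.barlowStacking a c s, dist (g z) (y i) ≤ 3 * a → ∃ j : Fin N, dist (y j) (g z) ≤ a / 50)} : ℝ) :=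
    mul_le_mul_of_nonneg_right (le_max_left _ _) (Nat.cast_nonneg _)
  linarith

/-- **`TruncatedCensusGap_of`** — the registered stubs give the crux BY NAME (reshape r2):
NEAR := NEAR′ ⇐ N3′ N2′, then the near/far glue with FAR.  (N1 `strainedBarlowMargin_holds` is PROVED and is an
input to any future proof of N2′, not to this composition.) -/
theorem TruncatedCensusGap_of (h₁ : Registered.stub_barlowFarSiteGap)
    (h₂ : Registered.stub_localNearPricing) : TruncatedCensusGap :=
  truncatedCensusGap_of_nearFarSplit h₁ (nearBarlowChargePricing_of_prime (stub_nearOfLocalPricing h₂))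

/-- Wiring check: the registered stubs feed `TruncatedCensusGap_of` as stated. -/
example : TruncatedCensusGap :=
  TruncatedCensusGap_of stub_barlowFarSiteGap stub_localNearPricing

/-- **THE CRUX MODULO ITS TWO OPEN CORES** (lead c5, end of cycle 1): `TruncatedCensusGap` follows from
FAR (`BarlowFarSiteGap`, far-site pricing = finite-range periodic crystallization for `V_χ`, coarse form) and
N2′ (`LocalNearPricing`, chart-free local pricing of deep-near sites); everything else of the line is PROVED
(N1 p169296, N3′ p169781, NEAR′→NEAR, near/far glue). -/
theorem truncatedCensusGap_of_far_of_localNearPricing (hFar : BarlowFarSiteGap)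
    (hLNP : LocalNearPricing) : TruncatedCensusGap :=
  TruncatedCensusGap_of hFar hLNP

/-! ## §5 Calibration (sorry-free): NEAR is a genuine, strictly weaker piece of the crux -/

/-- The crux implies NEAR (allowance `C = 0`: a near-and-charged site is charged). -/
theorem nearBarlowChargePricing_of_truncatedCensusGap (h : TruncatedCensusGap) :
    NearBarlowChargePricing := by
  obtain ⟨κ, hκ, h⟩ := h
  refine ⟨κ, 0, hκ, fun N y hy => ?_⟩
  have h1 := h N y hy
  rw [zero_mul, add_zero]
  refine le_trans ?_ h1
  have hle := Nat.card_le_card_of_injective _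
    (Subtype.impEmbedding
      (fun i : Fin N => ¬ IsChargeFree (1 / 100 : ℝ) y i ∧ ∃ (a c : ℝ) (s : ℤ → ℤ) (g : EuclideanSpace ℝ (Fin 3) ≃ᵃⁱ[ℝ] EuclideanSpace ℝ (Fin 3)), 93 / 100 ≤ a ∧ a ≤ 51 / 50 ∧ 78 / 100 * a ≤ c ∧ c ≤ 86 / 100 * a ∧ Literature.MathematicalPhysics.StatisticalMechanics.IsHaggSeq s ∧ (∀ j k : Fin N, j ≠ k → dist (y j) (y i) ≤ 3 * a → a / 2 ≤ dist (y j) (y k)) ∧ (∀ j : Fin N, dist (y j) (y i) ≤ 3 * a → ∃ z ∈ Literature.MathematicalPhysics.StatisticalMechanics.barlowStacking a c s, dist (y j) (g z) ≤ a / 50) ∧ (∀ z ∈ Literature.MathematicalPhysics.StatisticalMechanics.barlowStacking a c s, dist (g z) (y i) ≤ 3 * a → ∃ j : Fin N, dist (y j) (g z) ≤ a / 50))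
      (fun i : Fin N => ¬ IsChargeFree (1 / 100 : ℝ) y i) fun i hi => hi.1).injective
  have hcast := (Nat.cast_le (α := ℝ)).mpr hle
  have hle' := mul_le_mul_of_nonneg_left hcast hκ.le
  linarith

end Summit.AtomisticToContinuum.Crystallization.Cruxes.TruncatedCensusGap.NearFarSplit

end
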